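import Literature.Analysis.ODE.RecessiveRate
import Literature.Analysis.ODE.GrowthChain
import Literature.Barriers.HubbardSuperconductivity.WeakCouplingCeiling
import HarnessLib

/-!
# Reciprocal rates of the barrier basis from ONE good sub-interval: end rates at the turning points
# and the diagonal product `g d / w₀` in the interior

Topic `Literature/Analysis/ODE` (namespace `Literature.Analysis.ODE`), continuing `RecessiveRate.lean`
(`tanh_mul_le_neg_deriv`, `tanh_mul_le_deriv`: Riccati comparison on an interval where `q ≥ k²`) and
`GrowthChain.lean` (`deriv_monotoneOn_of_nonneg`: the derivative of a non-negative solution of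
`y″ = q y`, `q ≥ 0`, is non-decreasing). Setting: the monotone two-end real basis `g, d` of
`y″ = q y` on a forbidden interval `[α, β]` (`q ≥ 0`; `g ≥ 1` non-decreasing with `g′(α) = 0`, `d ≥ 1`
non-increasing with `d′(β) = 0`, Wronskian `g′ d − g d′ ≡ w₀`; `BarrierBasis.exists_barrierBasis`). At
the END POINTS of a barrier bounded by turning points the coefficient vanishes, so no uniform
`q ≥ k² > 0` is available on all of `[α, β]`; nevertheless the three reciprocal rates consumed by the
deep-barrier kernel bound (`DeepBarrierKernelBound.kernel_le_of_deep_barrier`: `d(α) ≤ R_α w₀`,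
`g(β) ≤ R_β w₀`, `g d ≤ R_m w₀`) follow from `q ≥ k²` on a SINGLE good sub-interval `[t₁, t₂]`:

* `tanh_rate_pos_and_inv_le` — `0 < k tanh(kℓ)` and `1/(k tanh(kℓ)) ≤ 2/k` once `kℓ ≥ 1` (the bound
  `tanh y ≥ ½` for `y ≥ 1` is the tree's `Literature.Barriers.HubbardSuperconductivity.half_le_tanh`,
  imported rather than restated);
* `le_add_mul_neg_deriv_of_convex` / `le_add_mul_deriv_of_convex` — convexity transport of the
  values to the ends: `d(α) ≤ d(t) + (t − α)(−d′(α))`, `g(β) ≤ g(t) + (β − t) g′(β)`;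
* `recessive_end_rate` — `d(α) ≤ ((t₁ − α) + 1/(k tanh(k(t₂ − t₁))))·(−d′(α))` whenever `q ≥ k²`
  (`k > 0`) on `[t₁, t₂] ⊆ [α, β]`, `t₁ < t₂` (the decay rate of `d` at `t₁` is at least
  `k tanh(k(t₂ − t₁))`, `−d′` only grows towards `α`, and `d` is convex);
* `growing_end_rate` — the mirror statement `g(β) ≤ ((β − t₂) + 1/(k tanh(k(t₂ − t₁))))·g′(β)`;
* `mul_le_wronskian_div_of_left` / `…_of_right` — in the interior, `g(x)d(x) ≤ w₀/(k tanh(k(x − t₁)))`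
  if `q ≥ k²` on `[t₁, x]`, and `g(x)d(x) ≤ w₀/(k tanh(k(t₂ − x)))` if `q ≥ k²` on `[x, t₂]` (from
  `w₀ = g′d + g(−d′) ≥` either summand and the Riccati rates).

With `k·(length) ≥ 1` every `1/(k tanh)` is `≤ 2/k`. One-interval real analysis; all proved. Used for the
Breitenlohner–Freedman-stable superradiant case of the cone Green-kernel bound of Carter's radial equation
(the Airy lengths at the two turning points and the collar rate), not here.

## References
* P. Hartman, *Ordinary Differential Equations* (SIAM Classics 38, 2002), Ch. XI Thm. 3.2, Ex. 3.1(a)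
  (Riccati comparison) and §6 (convex positive solutions). Key `Hartman2002`. Folklore otherwise.
-/

noncomputable section

open Set

namespace Literature.Analysis.ODE

/-! ### Scalar helpers -/

/-- `0 < k tanh(k ℓ)` for `k > 0`, `ℓ > 0`, and `1/(k tanh(k ℓ)) ≤ 2/k` once `k ℓ ≥ 1`. [folklore] -/
theorem tanh_rate_pos_and_inv_le {k ℓ : ℝ} (hk : 0 < k) (hℓ : 0 < ℓ) :
    0 < k * Real.tanh (k * ℓ) ∧ (1 ≤ k * ℓ → 1 / (k * Real.tanh (k * ℓ)) ≤ 2 / k) := by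
  have hkℓ : 0 < k * ℓ := mul_pos hk hℓ
  have ht : 0 < Real.tanh (k * ℓ) := by
    rw [Real.tanh_eq_sinh_div_cosh]
    exact div_pos (Real.sinh_pos_iff.2 hkℓ) (Real.cosh_pos _)
  refine ⟨mul_pos hk ht, fun h1 ↦ ?_⟩
  have h2 : 1 / 2 ≤ Real.tanh (k * ℓ) := Literature.Barriers.HubbardSuperconductivity.half_le_tanh h1
  rw [div_le_div_iff₀ (mul_pos hk ht) hk]
  nlinarith

/-! ### Convexity transport of the end values -/

/-- **Convexity, recessive branch**: if `d″ = q d` on `[α, t]` with `q ≥ 0`, `d ≥ 0`, then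
`d(α) ≤ d(t) + (t − α)·(−d′(α))` (`d′` is non-decreasing, so `d′ ≥ d′(α)` on `[α, t]`). [folklore] -/
theorem le_add_mul_neg_deriv_of_convex {d d' q : ℝ → ℝ} {α t : ℝ} (hαt : α ≤ t)
    (hd : ∀ s ∈ Icc α t, HasDerivAt d (d' s) s ∧ HasDerivAt d' (q s * d s) s)
    (hq0 : ∀ s ∈ Icc α t, 0 ≤ q s) (hd0 : ∀ s ∈ Icc α t, 0 ≤ d s) :
    d α ≤ d t + (t - α) * (-d' α) := by
  have hmono := deriv_monotoneOn_of_nonneg hd hq0 hd0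
  -- `h(s) = d(s) − d′(α)(s − α)` is non-decreasing on `[α, t]`
  have hH : ∀ s ∈ Icc α t, HasDerivAt (fun s ↦ d s - d' α * (s - α)) (d' s - d' α) s := fun s hs ↦ by
    have h1 : HasDerivAt (fun y ↦ d' α * (y - α)) (d' α * 1) s :=
      ((hasDerivAt_id' s).sub_const α).const_mul (d' α)
    exact ((hd s hs).1.sub h1).congr_deriv (by ring)
  have hHm : MonotoneOn (fun s ↦ d s - d' α * (s - α)) (Icc α t) :=
    monotoneOn_of_deriv_nonneg (convex_Icc α t)
      (fun s hs ↦ (hH s hs).continuousAt.continuousWithinAt)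
      (fun s hs ↦ (hH s (interior_subset hs)).differentiableAt.differentiableWithinAt)
      fun s hs ↦ by
        have hs' : s ∈ Icc α t := interior_subset hs
        rw [(hH s hs').deriv]
        exact sub_nonneg.2 (hmono (left_mem_Icc.2 hαt) hs' hs'.1)
  have h := hHm (left_mem_Icc.2 hαt) (right_mem_Icc.2 hαt) hαt
  simp only [sub_self, mul_zero, sub_zero] at h
  linarith

/-- **Convexity, growing branch**: if `g″ = q g` on `[t, β]` with `q ≥ 0`, `g ≥ 0`, then
`g(β) ≤ g(t) + (β − t)·g′(β)` (`g′ ≤ g′(β)` on `[t, β]`). [folklore] -/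
theorem le_add_mul_deriv_of_convex {g g' q : ℝ → ℝ} {t β : ℝ} (htβ : t ≤ β)
    (hg : ∀ s ∈ Icc t β, HasDerivAt g (g' s) s ∧ HasDerivAt g' (q s * g s) s)
    (hq0 : ∀ s ∈ Icc t β, 0 ≤ q s) (hg0 : ∀ s ∈ Icc t β, 0 ≤ g s) :
    g β ≤ g t + (β - t) * g' β := by
  have hmono := deriv_monotoneOn_of_nonneg hg hq0 hg0
  -- `h(s) = g(s) − g′(β)(s − t)` is non-increasing on `[t, β]`
  have hH : ∀ s ∈ Icc t β, HasDerivAt (fun s ↦ g s - g' β * (s - t)) (g' s - g' β) s := fun s hs ↦ by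
    have h1 : HasDerivAt (fun y ↦ g' β * (y - t)) (g' β * 1) s :=
      ((hasDerivAt_id' s).sub_const t).const_mul (g' β)
    exact ((hg s hs).1.sub h1).congr_deriv (by ring)
  have hHa : AntitoneOn (fun s ↦ g s - g' β * (s - t)) (Icc t β) :=
    antitoneOn_of_deriv_nonpos (convex_Icc t β)
      (fun s hs ↦ (hH s hs).continuousAt.continuousWithinAt)
      (fun s hs ↦ (hH s (interior_subset hs)).differentiableAt.differentiableWithinAt)
      fun s hs ↦ by
        have hs' : s ∈ Icc t β := interior_subset hs
        rw [(hH s hs').deriv]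
        exact sub_nonpos.2 (hmono hs' (right_mem_Icc.2 htβ) hs'.2)
  have h := hHa (left_mem_Icc.2 htβ) (right_mem_Icc.2 htβ) htβ
  simp only [sub_self, mul_zero, sub_zero] at h
  linarith

/-! ### End rates from one good sub-interval -/

/-- **Reciprocal decay rate of the recessive branch at the left end.** Let `d″ = q d` on `[α, β]` with
`q ≥ 0`, `d ≥ 0`, `d′ ≤ 0` there, and let `α ≤ t₁ < t₂ ≤ β` with `q ≥ k²` on `[t₁, t₂]`, `k > 0`. Then
`d(α) ≤ ((t₁ − α) + 1/(k·tanh(k(t₂ − t₁))))·(−d′(α))`. [folklore] -/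
theorem recessive_end_rate {d d' q : ℝ → ℝ} {α β t₁ t₂ k : ℝ}
    (hd : ∀ s ∈ Icc α β, HasDerivAt d (d' s) s ∧ HasDerivAt d' (q s * d s) s)
    (hq0 : ∀ s ∈ Icc α β, 0 ≤ q s) (hd0 : ∀ s ∈ Icc α β, 0 ≤ d s) (hd'0 : ∀ s ∈ Icc α β, d' s ≤ 0)
    (hαt : α ≤ t₁) (ht : t₁ < t₂) (htβ : t₂ ≤ β) (hk : 0 < k) (hqk : ∀ s ∈ Icc t₁ t₂, k ^ 2 ≤ q s) :
    d α ≤ ((t₁ - α) + 1 / (k * Real.tanh (k * (t₂ - t₁)))) * (-d' α) := by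
  have hsub₁ : Icc α t₁ ⊆ Icc α β := Icc_subset_Icc le_rfl (ht.le.trans htβ)
  have hsub₂ : Icc t₁ t₂ ⊆ Icc α β := Icc_subset_Icc hαt htβ
  obtain ⟨hr0, -⟩ := tanh_rate_pos_and_inv_le hk (sub_pos.2 ht)
  -- the rate at `t₁`, transported to `α`
  have h1 : k * Real.tanh (k * (t₂ - t₁)) * d t₁ ≤ -d' t₁ :=
    tanh_mul_le_neg_deriv (fun s hs ↦ hd s (hsub₂ hs)) hqk (fun s hs ↦ hd0 s (hsub₂ hs))
      (hd'0 t₂ ⟨hαt.trans ht.le, htβ⟩) t₁ (left_mem_Icc.2 ht.le)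
  have h2 : d' α ≤ d' t₁ :=
    deriv_monotoneOn_of_nonneg hd hq0 hd0 (left_mem_Icc.2 (hαt.trans (ht.le.trans htβ)))
      (hsub₂ (left_mem_Icc.2 ht.le)) hαt
  have h3 : d α ≤ d t₁ + (t₁ - α) * (-d' α) :=
    le_add_mul_neg_deriv_of_convex hαt (fun s hs ↦ hd s (hsub₁ hs)) (fun s hs ↦ hq0 s (hsub₁ hs))
      fun s hs ↦ hd0 s (hsub₁ hs)
  have h4 : d t₁ ≤ 1 / (k * Real.tanh (k * (t₂ - t₁))) * (-d' α) := by
    rw [one_div, ← div_eq_inv_mul, le_div_iff₀ hr0]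
    linarith
  calc d α ≤ d t₁ + (t₁ - α) * (-d' α) := h3
    _ ≤ 1 / (k * Real.tanh (k * (t₂ - t₁))) * (-d' α) + (t₁ - α) * (-d' α) := by linarith
    _ = ((t₁ - α) + 1 / (k * Real.tanh (k * (t₂ - t₁)))) * (-d' α) := by ring

/-- **Reciprocal growth rate of the growing branch at the right end.** Let `g″ = q g` on `[α, β]` with
`q ≥ 0`, `g ≥ 0`, `g′ ≥ 0` there, and let `α ≤ t₁ < t₂ ≤ β` with `q ≥ k²` on `[t₁, t₂]`, `k > 0`. Then
`g(β) ≤ ((β − t₂) + 1/(k·tanh(k(t₂ − t₁))))·g′(β)`. [folklore] -/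
theorem growing_end_rate {g g' q : ℝ → ℝ} {α β t₁ t₂ k : ℝ}
    (hg : ∀ s ∈ Icc α β, HasDerivAt g (g' s) s ∧ HasDerivAt g' (q s * g s) s)
    (hq0 : ∀ s ∈ Icc α β, 0 ≤ q s) (hg0 : ∀ s ∈ Icc α β, 0 ≤ g s) (hg'0 : ∀ s ∈ Icc α β, 0 ≤ g' s)
    (hαt : α ≤ t₁) (ht : t₁ < t₂) (htβ : t₂ ≤ β) (hk : 0 < k) (hqk : ∀ s ∈ Icc t₁ t₂, k ^ 2 ≤ q s) :
    g β ≤ ((β - t₂) + 1 / (k * Real.tanh (k * (t₂ - t₁)))) * g' β := by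
  have hsub₂ : Icc t₁ t₂ ⊆ Icc α β := Icc_subset_Icc hαt htβ
  have hsub₃ : Icc t₂ β ⊆ Icc α β := Icc_subset_Icc (hαt.trans ht.le) le_rfl
  obtain ⟨hr0, -⟩ := tanh_rate_pos_and_inv_le hk (sub_pos.2 ht)
  have h1 : k * Real.tanh (k * (t₂ - t₁)) * g t₂ ≤ g' t₂ :=
    tanh_mul_le_deriv (fun s hs ↦ hg s (hsub₂ hs)) hqk (fun s hs ↦ hg0 s (hsub₂ hs))
      (hg'0 t₁ ⟨hαt, ht.le.trans htβ⟩) t₂ (right_mem_Icc.2 ht.le)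
  have h2 : g' t₂ ≤ g' β :=
    deriv_monotoneOn_of_nonneg hg hq0 hg0 (hsub₂ (right_mem_Icc.2 ht.le))
      (right_mem_Icc.2 (hαt.trans (ht.le.trans htβ))) htβ
  have h3 : g β ≤ g t₂ + (β - t₂) * g' β :=
    le_add_mul_deriv_of_convex htβ (fun s hs ↦ hg s (hsub₃ hs)) (fun s hs ↦ hq0 s (hsub₃ hs))
      fun s hs ↦ hg0 s (hsub₃ hs)
  have h4 : g t₂ ≤ 1 / (k * Real.tanh (k * (t₂ - t₁))) * g' β := by
    rw [one_div, ← div_eq_inv_mul, le_div_iff₀ hr0]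
    linarith
  calc g β ≤ g t₂ + (β - t₂) * g' β := h3
    _ ≤ 1 / (k * Real.tanh (k * (t₂ - t₁))) * g' β + (β - t₂) * g' β := by linarith
    _ = ((β - t₂) + 1 / (k * Real.tanh (k * (t₂ - t₁)))) * g' β := by ring

/-! ### The diagonal product `g d / w₀` in the interior -/

/-- **`g d ≤ w₀/(k tanh(k(x − t₁)))` from a good interval on the left.** Let `g″ = q g` on `[t₁, x]`
with `q ≥ k²` (`k > 0`, `t₁ < x`), `g ≥ 0` there, `g′(t₁) ≥ 0`; let `d(x) ≥ 0`, `d′(x) ≤ 0` and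
`g′(x) d(x) − g(x) d′(x) = w₀`. Then `g(x) d(x) ≤ w₀/(k·tanh(k(x − t₁)))`. [folklore] -/
theorem mul_le_wronskian_div_of_left {g g' q : ℝ → ℝ} {t₁ x k w₀ dx d'x : ℝ}
    (hg : ∀ s ∈ Icc t₁ x, HasDerivAt g (g' s) s ∧ HasDerivAt g' (q s * g s) s)
    (hqk : ∀ s ∈ Icc t₁ x, k ^ 2 ≤ q s) (hg0 : ∀ s ∈ Icc t₁ x, 0 ≤ g s) (hg't₁ : 0 ≤ g' t₁)
    (hk : 0 < k) (htx : t₁ < x) (hdx : 0 ≤ dx) (hd'x : d'x ≤ 0) (hW : g' x * dx - g x * d'x = w₀) :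
    g x * dx ≤ w₀ / (k * Real.tanh (k * (x - t₁))) := by
  obtain ⟨hr0, -⟩ := tanh_rate_pos_and_inv_le hk (sub_pos.2 htx)
  have h1 : k * Real.tanh (k * (x - t₁)) * g x ≤ g' x :=
    tanh_mul_le_deriv hg hqk hg0 hg't₁ x (right_mem_Icc.2 htx.le)
  have hgx : 0 ≤ g x := hg0 x (right_mem_Icc.2 htx.le)
  rw [le_div_iff₀ hr0]
  -- `k tanh · g d ≤ g′ d ≤ g′ d + g (−d′) = w₀`
  have h2 : k * Real.tanh (k * (x - t₁)) * g x * dx ≤ g' x * dx := mul_le_mul_of_nonneg_right h1 hdx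
  have h3 : 0 ≤ g x * (-d'x) := mul_nonneg hgx (by linarith)
  nlinarith

/-- **`g d ≤ w₀/(k tanh(k(t₂ − x)))` from a good interval on the right.** Let `d″ = q d` on `[x, t₂]`
with `q ≥ k²` (`k > 0`, `x < t₂`), `d ≥ 0` there, `d′(t₂) ≤ 0`; let `g(x) ≥ 0`, `g′(x) ≥ 0` and
`g′(x) d(x) − g(x) d′(x) = w₀`. Then `g(x) d(x) ≤ w₀/(k·tanh(k(t₂ − x)))`. [folklore] -/
theorem mul_le_wronskian_div_of_right {d d' q : ℝ → ℝ} {x t₂ k w₀ gx g'x : ℝ}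
    (hd : ∀ s ∈ Icc x t₂, HasDerivAt d (d' s) s ∧ HasDerivAt d' (q s * d s) s)
    (hqk : ∀ s ∈ Icc x t₂, k ^ 2 ≤ q s) (hd0 : ∀ s ∈ Icc x t₂, 0 ≤ d s) (hd't₂ : d' t₂ ≤ 0)
    (hk : 0 < k) (hxt : x < t₂) (hgx : 0 ≤ gx) (hg'x : 0 ≤ g'x) (hW : g'x * d x - gx * d' x = w₀) :
    gx * d x ≤ w₀ / (k * Real.tanh (k * (t₂ - x))) := by
  obtain ⟨hr0, -⟩ := tanh_rate_pos_and_inv_le hk (sub_pos.2 hxt)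
  have h1 : k * Real.tanh (k * (t₂ - x)) * d x ≤ -d' x :=
    tanh_mul_le_neg_deriv hd hqk hd0 hd't₂ x (left_mem_Icc.2 hxt.le)
  have hdx : 0 ≤ d x := hd0 x (left_mem_Icc.2 hxt.le)
  rw [le_div_iff₀ hr0]
  have h2 : k * Real.tanh (k * (t₂ - x)) * d x * gx ≤ -d' x * gx := mul_le_mul_of_nonneg_right h1 hgx
  have h3 : 0 ≤ g'x * d x := mul_nonneg hg'x hdx
  nlinarith

/-- **Assembled reciprocal rates for the barrier basis.** For the monotone two-end basis `g, d` of
`y″ = q y` on `[α, β]` (`q ≥ 0`; sign data `g ≥ 1`, `g′ ≥ 0`, `d ≥ 1`, `d′ ≤ 0`; `g(α) = 1`, `g′(α) = 0`,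
`g′(β) = w₀`, Wronskian `g d′ − g′ d ≡ −w₀`) and ONE good sub-interval `α ≤ t₁ < t₂ ≤ β` with `q ≥ k²` (`k > 0`) on it:
`d(α) ≤ ((t₁ − α) + 1/(k tanh(k(t₂ − t₁))))·w₀` (note `−d′(α) = w₀`),
`g(β) ≤ ((β − t₂) + 1/(k tanh(k(t₂ − t₁))))·w₀` (`g′(β) = w₀`), and for every `x ∈ (t₁, t₂)`:
`g(x)d(x) ≤ w₀/(k tanh(k(x − t₁)))` and `g(x)d(x) ≤ w₀/(k tanh(k(t₂ − x)))`. [folklore] -/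
theorem barrierBasis_rates {q g g' d d' : ℝ → ℝ} {α β w₀ t₁ t₂ k : ℝ}
    (hg : ∀ x ∈ Icc α β, HasDerivAt g (g' x) x ∧ HasDerivAt g' (q x * g x) x)
    (hd : ∀ x ∈ Icc α β, HasDerivAt d (d' x) x ∧ HasDerivAt d' (q x * d x) x)
    (hq0 : ∀ x ∈ Icc α β, 0 ≤ q x) (hg'α : g' α = 0) (hg'β : g' β = w₀)
    (hsign : ∀ x ∈ Icc α β, 1 ≤ g x ∧ 0 ≤ g' x ∧ 1 ≤ d x ∧ d' x ≤ 0)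
    (hW : ∀ x ∈ Icc α β, g x * d' x - g' x * d x = -w₀) (hgα : g α = 1)
    (hαt : α ≤ t₁) (ht : t₁ < t₂) (htβ : t₂ ≤ β) (hk : 0 < k) (hqk : ∀ s ∈ Icc t₁ t₂, k ^ 2 ≤ q s) :
    d α ≤ ((t₁ - α) + 1 / (k * Real.tanh (k * (t₂ - t₁)))) * w₀ ∧
    g β ≤ ((β - t₂) + 1 / (k * Real.tanh (k * (t₂ - t₁)))) * w₀ ∧
    ∀ x ∈ Ioo t₁ t₂, g x * d x ≤ w₀ / (k * Real.tanh (k * (x - t₁))) ∧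
      g x * d x ≤ w₀ / (k * Real.tanh (k * (t₂ - x))) := by
  have hαβ : α ≤ β := hαt.trans (ht.le.trans htβ)
  have hα : α ∈ Icc α β := left_mem_Icc.2 hαβ
  have hg0 : ∀ x ∈ Icc α β, 0 ≤ g x := fun x hx ↦ by linarith [(hsign x hx).1]
  have hd0 : ∀ x ∈ Icc α β, 0 ≤ d x := fun x hx ↦ by linarith [(hsign x hx).2.2.1]
  have hg'0 : ∀ x ∈ Icc α β, 0 ≤ g' x := fun x hx ↦ (hsign x hx).2.1
  have hd'0 : ∀ x ∈ Icc α β, d' x ≤ 0 := fun x hx ↦ (hsign x hx).2.2.2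
  have hd'α : -d' α = w₀ := by
    have h := hW α hα; rw [hgα, hg'α, one_mul, zero_mul, sub_zero] at h; linarith
  refine ⟨?_, ?_, fun x hx ↦ ?_⟩
  · have h := recessive_end_rate hd hq0 hd0 hd'0 hαt ht htβ hk hqk
    rwa [hd'α] at h
  · have h := growing_end_rate hg hq0 hg0 hg'0 hαt ht htβ hk hqk
    rwa [hg'β] at h
  · have hxI : x ∈ Icc α β := ⟨hαt.trans hx.1.le, hx.2.le.trans htβ⟩
    have hWx : g' x * d x - g x * d' x = w₀ := by linarith [hW x hxI]
    have hsubL : Icc t₁ x ⊆ Icc α β := Icc_subset_Icc hαt hxI.2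
    have hsubR : Icc x t₂ ⊆ Icc α β := Icc_subset_Icc hxI.1 htβ
    constructor
    · exact mul_le_wronskian_div_of_left (fun s hs ↦ hg s (hsubL hs))
        (fun s hs ↦ hqk s ⟨hs.1, hs.2.trans hx.2.le⟩) (fun s hs ↦ hg0 s (hsubL hs))
        (hg'0 t₁ ⟨hαt, ht.le.trans htβ⟩) hk hx.1 (hd0 x hxI) (hd'0 x hxI) hWx
    · exact mul_le_wronskian_div_of_right (fun s hs ↦ hd s (hsubR hs))
        (fun s hs ↦ hqk s ⟨hx.1.le.trans hs.1, hs.2⟩) (fun s hs ↦ hd0 s (hsubR hs))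
        (hd'0 t₂ ⟨hαt.trans ht.le, htβ⟩) hk hx.2 (hg0 x hxI) (hg'0 x hxI) hWx

end Literature.Analysis.ODE

end
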